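import Summits.QuantumFields.YangMills.Theorems.LuscherReductionTwistedTraceScalingCovariantCurlCovariance
import HarnessLib

/-!
# Gauge invariance of the covariant stiffness form: `‖D_{U^g}(R_g w)‖ = ‖D_U w‖` with `R_g` an isometry of `LinkSpace L` (brick c2 part iii)
# (lane B of S-BASE, crux `TwistedTraceScaling` stmt-QuantumFields-20203; covariant reformulation of the Laplace step, blueprint §5–§6)

Operator form of `…CovariantCurlCovariance.covCurl_gaugeTransform`: `D_{U^g} ∘ R_g = R'_g ∘ D_U` with the base-point rotations `R_g = rotLink g`
(links) and `R'_g = rotPlaq g` (plaquettes), both norm preserving (`Ad(g_x) ∈ SO(3)` colour by colour).  Hence the quadratic form of the covariant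
stiffness Hessian `D_U†D_U` is gauge invariant up to the isometry `R_g`: `⟪R_g w, D_{U^g}†D_{U^g} R_g w⟫ = ⟪w, D_U†D_U w⟫` — its normal modes, and the
harmonic eigenvalue `Λ(U)` built from them, depend only on the gauge class of `U`.
HONEST FRAMING: algebra; femto rung R2b1 (stub of a child of a CONDITIONAL route); not a gap, not Clay.
-/

set_option autoImplicit false

noncomputable section

open scoped Matrix BigOperators RealInnerProductSpace
open Literature.MathematicalPhysics.QuantumFieldTheory
open Literature.MathematicalPhysics.QuantumLattice

namespace Summit.QuantumFields.YangMills.Theorems.FemtoTransferGap.TwoLattice.Cov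

open Summit.QuantumFields.YangMills.Theorems.FemtoTransferGap
open Summit.QuantumFields.YangMills.Theorems.FemtoTransferGap.TwoLattice
open Summit.QuantumFields.YangMills.Theorems.FemtoTransferGap.TwoLattice.Stiff

variable {L : ℕ} [NeZero L]

/-- Rotation of plaquette 2-forms at their base points: `(rotPlaq g F)(p, ·) = Ad(g_{x_p}) F(p, ·)`. [folklore] -/
def rotPlaq (g : Site 3 L → SU2) (F : PlaqSpace L) : PlaqSpace L :=
  WithLp.toLp 2 fun pa : Plaquette 3 L × Fin 3 => (adRot (g pa.1.1)).mulVec (fun b => F (pa.1, b)) pa.2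

omit [NeZero L] in
/-- Components of `rotPlaq`. [folklore] -/
@[simp] theorem rotPlaq_apply (g : Site 3 L → SU2) (F : PlaqSpace L) (p : Plaquette 3 L) (a : Fin 3) :
    rotPlaq g F (p, a) = (adRot (g p.1)).mulVec (fun b => F (p, b)) a := rfl

omit [NeZero L] in
/-- ★ Operator form of covariance: `D_{U^g}(R_g w) = R'_g(D_U w)`. [cite: Luscher1983, §3] -/
theorem covCurl_gaugeTransform_eq (g : Site 3 L → SU2) (U : GaugeConfig 3 L SU2) (w : LinkSpace L) :
    covCurl (gaugeTransform g U) (rotLink g w) = rotPlaq g (covCurl U w) := by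
  ext ⟨p, a⟩
  rw [covCurl_gaugeTransform, rotPlaq_apply]

/-- `R_g` preserves the norm of `LinkSpace L`. [folklore] -/
theorem norm_rotLink (g : Site 3 L → SU2) (w : LinkSpace L) : ‖rotLink g w‖ = ‖w‖ := by
  have h : ‖rotLink g w‖ ^ 2 = ‖w‖ ^ 2 := by
    rw [EuclideanSpace.norm_sq_eq, EuclideanSpace.norm_sq_eq,
      Fintype.sum_prod_type (f := fun x : Edge 3 L × Fin 3 => ‖rotLink g w x‖ ^ 2),
      Fintype.sum_prod_type (f := fun x : Edge 3 L × Fin 3 => ‖w x‖ ^ 2)]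
    refine Finset.sum_congr rfl fun e _ => ?_
    simp only [Real.norm_eq_abs, sq_abs, rotLink_apply]
    exact sum_sq_adRot_mulVec (g e.1) fun b => w (e, b)
  nlinarith [norm_nonneg (rotLink g w), norm_nonneg w, sq_nonneg (‖rotLink g w‖ - ‖w‖)]

/-- `R'_g` preserves the norm of `PlaqSpace L`. [folklore] -/
theorem norm_rotPlaq (g : Site 3 L → SU2) (F : PlaqSpace L) : ‖rotPlaq g F‖ = ‖F‖ := by
  have h : ‖rotPlaq g F‖ ^ 2 = ‖F‖ ^ 2 := by
    rw [EuclideanSpace.norm_sq_eq, EuclideanSpace.norm_sq_eq,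
      Fintype.sum_prod_type (f := fun x : Plaquette 3 L × Fin 3 => ‖rotPlaq g F x‖ ^ 2),
      Fintype.sum_prod_type (f := fun x : Plaquette 3 L × Fin 3 => ‖F x‖ ^ 2)]
    refine Finset.sum_congr rfl fun p _ => ?_
    simp only [Real.norm_eq_abs, sq_abs, rotPlaq_apply]
    exact sum_sq_adRot_mulVec (g p.1) fun b => F (p, b)
  nlinarith [norm_nonneg (rotPlaq g F), norm_nonneg F, sq_nonneg (‖rotPlaq g F‖ - ‖F‖)]

/-- ★ **The covariant stiffness is gauge invariant**: `‖D_{U^g}(R_g w)‖ = ‖D_U w‖`. [cite: Luscher1983, §3] -/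
theorem norm_covCurl_gaugeTransform (g : Site 3 L → SU2) (U : GaugeConfig 3 L SU2) (w : LinkSpace L) :
    ‖covCurl (gaugeTransform g U) (rotLink g w)‖ = ‖covCurl U w‖ := by
  rw [covCurl_gaugeTransform_eq, norm_rotPlaq]

/-- The quadratic form of `D†D` is `‖D w‖²`. [folklore] -/
theorem inner_covHessian (U : GaugeConfig 3 L SU2) (w : LinkSpace L) :
    ⟪w, ((covCurl U).adjoint ∘ₗ covCurl U) w⟫ = ‖covCurl U w‖ ^ 2 := by
  rw [LinearMap.comp_apply, LinearMap.adjoint_inner_right, real_inner_self_eq_norm_sq]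

/-- ★ **Gauge invariance of the covariant Hessian's quadratic form** (up to the isometry `R_g`):
`⟪R_g w, D_{U^g}†D_{U^g} R_g w⟫ = ⟪w, D_U†D_U w⟫`. [cite: Luscher1983, §3] -/
theorem inner_covHessian_gaugeTransform (g : Site 3 L → SU2) (U : GaugeConfig 3 L SU2) (w : LinkSpace L) :
    ⟪rotLink g w, ((covCurl (gaugeTransform g U)).adjoint ∘ₗ covCurl (gaugeTransform g U)) (rotLink g w)⟫ =
      ⟪w, ((covCurl U).adjoint ∘ₗ covCurl U) w⟫ := by
  rw [inner_covHessian, inner_covHessian, norm_covCurl_gaugeTransform]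

/-- The covariant Hessian is a positive operator (every `U`). [folklore] -/
theorem covHessian_isPositive (U : GaugeConfig 3 L SU2) : ((covCurl U).adjoint ∘ₗ covCurl U).IsPositive := by
  refine ⟨?_, fun w => ?_⟩
  · -- symmetric: `(D†D)† = D†D`
    intro v w'
    rw [LinearMap.comp_apply, LinearMap.comp_apply, LinearMap.adjoint_inner_left, ← LinearMap.adjoint_inner_right]
  · have h : ⟪((covCurl U).adjoint ∘ₗ covCurl U) w, w⟫ = ‖covCurl U w‖ ^ 2 := by
      rw [real_inner_comm, inner_covHessian]
    rw [h]
    simp only [RCLike.re_to_real]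
    positivity

end Summit.QuantumFields.YangMills.Theorems.FemtoTransferGap.TwoLattice.Cov

end
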